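import Summits.QuantumFields.YangMills.Theorems.DiagonalMirrorRPRWilsonDiagonalModelInsertion
import Summits.QuantumFields.YangMills.Theorems.DiagonalMirrorRPRWilsonDiagonalModelPairChain

/-!
# Crux `WeakCouplingHypercubicLimitRP` (stmt-QuantumFields-27398) / aside `DiagonalMirrorRPR` (stmt-QuantumFields-10604), door B,
# construction F1_diag — PAIRING LAYER, step P2″: the insertion form over HALF-LAYER PAIRS (the variables of hand-1's feature lift), with the
# mirrored insertion written as the family observable on the REFLECTED pair string

Helper file (`--supports stmt-QuantumFields-27398 --as helper`) of the hand `hand-10604-wilsonDiagModel-2` (docket director-ym g23, O4 WORD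
18 (3)(iii) / 20 (1); the entry point of step P3 (sandwich) of hand-1's ROADMAP-F1diag v4 §1⅞ / hand-2's addendum v5) for the registered stub D1
`stub_diagRPOfPlaneLimits` of `Cruxes/WeakCouplingHypercubicLimitRP/Lines/Sketch.lean` (sha16 `7bf38c709623ad77`); it closes nothing by itself.

WHAT.
* §1 `swap_layerAssembleU_eq` — the swapped assembled configuration IS the configuration assembled from the REFLECTED layer string
  `t ↦ glue (Θ (bonds Z_{1−t})) (inslab Z_{−t})` (odd `S`; `layerReadU_swap_layerAssembleU` of `…Insertion` + `layerAssembleU_layerReadU`); on pair strings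
  `P t = (Y_t, X_t)`: `reflectPairs P t = (Θ Y_{1−t}, X_{−t})`, an involution (`reflectPairs_reflectPairs`).
* §2 **`gramPairing_mul_diagCyclicTraceU_eq_integral_pairs`** (P2″): for every reflected family `F` and step `k`,
  `gramPairing r sch F k · Tr K_u^{S_k} = ∫ Y_k(F)((assemble ∘ glue ∘ reflectPairs P)~) · Y_k(F)((assemble ∘ glue ∘ P)~) ·
     ∏_t e^{β even(Y_t, X_t, Y_{t+1})} e^{β odd(X_t, Y_{t+1}, X_{t+1})} d(halfHaar ⊗ halfHaar)^{⊗ ℤ/S_kℤ}(P)`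
  — the insertion form of P2 (`gramPairing_mul_diagCyclicTraceU_eq`, ✓p828057) pulled back along hand-1's measure-preserving `glueEquiv` per layer
  (exactly as `diagCyclicTraceU_eq_integral_pairs`, ✓p826814), with the two-step kernel split into its even and odd half steps (`stepKernelU_glue`).
  This is the literal starting point of P3c (expand the even steps OUTSIDE the block `t ∈ (−d, d)` by `hasSum_natFeature_mul`, fold onto the lifted
  kernel `𝔞`/`𝔟`, keep the block with the two insertions as the kernel `kW` between the boundary states `(k_{−d}, X_{−d})`, `(k_d, X_d)` — addendum v5).

HONEST FRAMING: bookkeeping only; `wilsonDiagonalModel` is NOT landed (P3 sandwich/positivity, P4, assembly remain); no letter is proved; D1, ⟨27398⟩, S6i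
and the aside ⟨10604⟩ are OPEN; nothing here bears on the summit; the Yang–Mills mass gap is NOT proved here or anywhere in the tree.  One plumbing
definition (`reflectPairs`, the reflection of a pair string; Type-valued), no `Prop` definition, no instance, no notation, `autoImplicit false`.

References: K. Osterwalder, E. Seiler, Ann. Phys. 110 (1978) §2–3; E. Seiler, LNP 159 (1982) Ch. 2.
-/

set_option autoImplicit false

noncomputable section

open scoped BigOperators
open MeasureTheory Filter Topology
open Literature.MathematicalPhysics.QuantumLattice Literature.MathematicalPhysics.AQFT
  Literature.MathematicalPhysics.QuantumFieldTheory

namespace Summit.QuantumFields.YangMills.Cruxes.DiagonalMirrorRPR.SignTwistedDiagonalTrace.WilsonDiagonal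

/-! ## §1 The swapped assembled configuration as an assembled reflected string -/

section Reflect

variable {S : ℕ} {G : Type*}

/-- **The reflection of a half-layer pair string**: `(Y_t, X_t)_t ↦ (Θ Y_{1−t}, X_{−t})_t` — the swap `x₀ ↔ x₁` read on (bond, in-slab) half layers
in the symmetric chart (fibrewise: no slab shift; bond labels twisted by `Θ`). -/
def reflectPairs (P : ZMod S → HalfCfg S S G × HalfCfg S S G) (t : ZMod S) : HalfCfg S S G × HalfCfg S S G :=
  (thetaHalf (P (1 - t)).1, (P (-t)).2)

/-- The reflection of pair strings is an involution. -/
theorem reflectPairs_reflectPairs (P : ZMod S → HalfCfg S S G × HalfCfg S S G) : reflectPairs (reflectPairs P) = P := by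
  funext t
  simp only [reflectPairs, sub_sub_cancel, neg_neg, thetaHalf_thetaHalf]

variable [MeasurableSpace G]

/-- **The swapped assembled configuration is assembled from the reflected layer string** (odd `S`):
`P_swap (assemble Z) = assemble (t ↦ glue (Θ bonds Z_{1−t}) (inslab Z_{−t}))`. -/
theorem swap_layerAssembleU_eq (hS : Odd S) (Z : ZMod S → LayerCfg S S G) :
    configPerm (Equiv.swap (0 : Fin 4) 1) (layerAssembleU Z) =
      layerAssembleU fun t => glue (thetaHalf (bonds (Z (1 - t)))) (inslab (Z (-t))) := by
  rw [← layerAssembleU_layerReadU hS (configPerm (Equiv.swap (0 : Fin 4) 1) (layerAssembleU Z))]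
  congr 1
  funext t
  exact layerReadU_swap_layerAssembleU hS Z t

/-- On pair strings: `P_swap (assemble (glue ∘ P)) = assemble (glue ∘ reflectPairs P)`. -/
theorem swap_layerAssembleU_glue_eq (hS : Odd S) (P : ZMod S → HalfCfg S S G × HalfCfg S S G) :
    configPerm (Equiv.swap (0 : Fin 4) 1) (layerAssembleU fun t => glue (P t).1 (P t).2) =
      layerAssembleU fun t => glue (reflectPairs P t).1 (reflectPairs P t).2 := by
  rw [swap_layerAssembleU_eq hS]
  simp only [reflectPairs, bonds_glue, inslab_glue]

end Reflect

/-! ## §2 P2″: the insertion form over half-layer pairs -/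

section Pairs

variable {G : Type} [Group G] [TopologicalSpace G] [IsTopologicalGroup G] [CompactSpace G]
  [MeasurableSpace G] [BorelSpace G] (r : LatticeRep G) (sch : SpeciesScheme (YMSpecies G))

/-- **P2″ — the insertion form over half-layer pairs.**  `gramPairing r sch F k · Tr K_u^{S_k}` is the integral, over strings of (bond, in-slab) half-layer
pairs `P t = (Y_t, X_t)` with the product half-layer Haar measure, of `Y_k(F)` at the assembled REFLECTED string times `Y_k(F)` at the assembled string
times the pair chain `∏_t e^{β even(Y_t,X_t,Y_{t+1})} e^{β odd(X_t,Y_{t+1},X_{t+1})}`. -/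
theorem gramPairing_mul_diagCyclicTraceU_eq_integral_pairs (F : ReflectedFamily) (k : ℕ) :
    gramPairing r sch F k * diagCyclicTraceU r.ρ (sch.β k) (sch.side k) (S := sch.side k) (G := G) =
      ∫ P : ZMod (sch.side k) → HalfCfg (sch.side k) (sch.side k) G × HalfCfg (sch.side k) (sch.side k) G,
          famObs r sch F k (torusLift (sch.side k) (layerAssembleU fun t => glue (reflectPairs P t).1 (reflectPairs P t).2)) *
              famObs r sch F k (torusLift (sch.side k) (layerAssembleU fun t => glue (P t).1 (P t).2)) *
            ∏ t : ZMod (sch.side k), Real.exp (sch.β k * evenActionU r.ρ (P t).1 (P t).2 (P (t + 1)).1) *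
              Real.exp (sch.β k * oddActionU r.ρ (P t).2 (P (t + 1)).1 (P (t + 1)).2)
        ∂(Measure.pi fun _ : ZMod (sch.side k) => (halfHaar (sch.side k) G).prod (halfHaar (sch.side k) G)) := by
  have hS : Odd (sch.side k) := ⟨sch.L k, rfl⟩
  set S := sch.side k with hSdef
  haveI : SigmaFinite (layerHaar S S G) := by unfold layerHaar; infer_instance
  haveI : SigmaFinite ((halfHaar S G).prod (halfHaar S G)) := by unfold halfHaar; infer_instance
  have hmp : MeasurePreserving (fun (P : ZMod S → HalfCfg S S G × HalfCfg S S G) (t : ZMod S) => glueEquiv (P t))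
      (Measure.pi fun _ : ZMod S => (halfHaar S G).prod (halfHaar S G)) (Measure.pi fun _ : ZMod S => layerHaar S S G) :=
    measurePreserving_pi _ _ fun _ => measurePreserving_glueEquiv
  rw [gramPairing_mul_diagCyclicTraceU_eq]
  rw [← hmp.integral_comp (MeasurableEquiv.piCongrRight fun _ : ZMod S =>
    (glueEquiv : HalfCfg S S G × HalfCfg S S G ≃ᵐ LayerCfg S S G)).measurableEmbedding]
  refine integral_congr_ae (ae_of_all _ fun P => ?_)
  dsimp only
  have hglue : (fun t : ZMod S => glueEquiv (P t)) = fun t => glue (P t).1 (P t).2 := by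
    funext t; exact glueEquiv_apply (P t).1 (P t).2
  rw [hglue, swap_layerAssembleU_glue_eq hS P]
  congr 1
  refine Finset.prod_congr rfl fun t _ => ?_
  rw [show glueEquiv (P t) = glue (P t).1 (P t).2 from glueEquiv_apply (P t).1 (P t).2,
    show glueEquiv (P (t + 1)) = glue (P (t + 1)).1 (P (t + 1)).2 from glueEquiv_apply (P (t + 1)).1 (P (t + 1)).2,
    stepKernelU_glue]

end Pairs

end Summit.QuantumFields.YangMills.Cruxes.DiagonalMirrorRPR.SignTwistedDiagonalTrace.WilsonDiagonal

end
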